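import Mathlib
import Summits.Ventures.PercRepro2.SwOutCrossGenThm

/-!
# The generic cross-arm cube with ONE extra dropped vertex (blind cell PercRepro2, night-4 g24,
2026-08-28; proofs/NIGHT4-G24.md §9; the definitions and the two core steps)

The abstract theorem of boundary (iv) for a connected dropped component TOGETHER WITH A SINGLE
DROPPED VERTEX at the same junction (the first several-component case: the single vertex is a
second component of size one).  A point is `(s, w, (a, e))`: the u-arm bits, the fibre point of
the component, the u-edge bit and the outside bit of the single vertex; the single vertex leaks
when attached with red outside edges (some u-arm red) or dropped with blue outside edges (some
u-arm blue); its atom is red when it is attached and some u-arm is red; its label is its outside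
bit (a blue outside edge is worse).  THE PROOF: at the CORE states of the single vertex (`a = e`)
the theorem for the component (`card_le_crossGen`) applies at frozen `(a, e)` and the single
vertex's bit is then a one-bit cube over which the cube principle turns the frozen blue count into
the true one (as the far arms of `card_le_crossGenFar`); the NON-CORE states (`dropped, blue
outside` on the T-slab, `attached, red outside` on the B-slab) are matched by an injection
`theta` of ALL non-red-leaking fibre points into non-blue-leaking ones (label-monotone,
atom-carrying — for the cross fibre: g23's `psi` on the non-core non-exceptional points, the
exceptional points to the all-attached-blue-outside points, the lower core points to
all-attached-red-outside, the upper core points to their flips), which `FibreDataBit` adds to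
`FibreData`.  **`card_le_crossGenBit`**: the red count is at most the blue count on every up-set
of types, for every up-set of atom sets.
-/

namespace Summit.Ventures.PercRepro2

namespace CrossArm

/-- **Fibre data with the injection `theta` of every non-red-leaking point** (label-monotone,
atom-carrying, injective), the datum the single extra vertex needs. -/
structure FibreDataBit (W A L : Type*) extends FibreData W A L where
  /-- the injection of the non-red-leaking points -/
  theta : W → W
  /-- `theta` lands in the non-blue-leaking points, with a better label, its flip carrying the
  red atoms of the source -/
  theta_ok : ∀ w, leakR w = false →
    leakR (flip (theta w)) = false ∧ BetterL (label (theta w)) (label w) ∧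
      ∀ a, red w a = true → red (flip (theta w)) a = true
  /-- `theta` is injective on the non-red-leaking points -/
  theta_inj : ∀ w w', leakR w = false → leakR w' = false → theta w = theta w' → w = w'

section Defs

variable (W A L : Type*) (ι : Type*)

/-- A point: the u-arm bits, the fibre point, the single vertex's (u-edge bit, outside bit). -/
abbrev PtBG := Config ι × W × (Bool × Bool)

/-- The atoms: those of the component's cube, and the single vertex. -/
abbrev AtomBG := AtomG (A ⊕ Unit) ι

/-- The type: the u-arm bits, the label, the single vertex's outside bit. -/
abbrev TypBG := Config ι × L × Bool

variable {W A L ι}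

/-- The atom of the single vertex. -/
def vAtom : AtomBG A ι := Sum.inr (Sum.inr (Sum.inr ()))

/-- The atom `u`. -/
def uAtomG : AtomG A ι := Sum.inr (Sum.inl ())

/-- The atoms of the component's cube as atoms of the extended cube. -/
def liftAtom : AtomG A ι → AtomBG A ι
  | Sum.inl j => Sum.inl j
  | Sum.inr (Sum.inl u) => Sum.inr (Sum.inl u)
  | Sum.inr (Sum.inr a) => Sum.inr (Sum.inr (Sum.inl a))

/-- `liftAtom` is injective. -/
lemma liftAtom_injective : Function.Injective (liftAtom : AtomG A ι → AtomBG A ι) := by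
  rintro (j | (u | a)) (j' | (u' | a')) h <;> simp [liftAtom] at h <;> simp [h]

/-- The vertex atom is not a lifted atom. -/
lemma vAtom_notMem_lift (S : Set (AtomG A ι)) : (vAtom : AtomBG A ι) ∉ liftAtom '' S := by
  rintro ⟨(j | (u | a)), -, h⟩ <;> simp [liftAtom, vAtom] at h

variable (F : FibreDataBit W A L)

/-- The leak: the component's, or the single vertex attached with red outside (some u-arm red),
or dropped with blue outside (some u-arm blue). -/
def LeakBG (x : PtBG W ι) : Prop :=
  LeakG F.toFibreData (x.1, x.2.1) ∨ (redUG x.1 ∧ x.2.2.1 = true ∧ x.2.2.2 = false) ∨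
    (blueUG x.1 ∧ x.2.2.1 = false ∧ x.2.2.2 = true)

/-- The red atoms: those of the component's cube, and the single vertex when attached with some
u-arm red. -/
def ERBG (x : PtBG W ι) : Set (AtomBG A ι) :=
  liftAtom '' ERG F.toFibreData (x.1, x.2.1) ∪ {a | a = vAtom ∧ x.2.2.1 = true ∧ redUG x.1}

/-- The total flip. -/
def flipBG (x : PtBG W ι) : PtBG W ι := (flipAll x.1, F.flip x.2.1, (!x.2.2.1, !x.2.2.2))

/-- The blue atoms: the red atoms of the flip. -/
def EBBG (x : PtBG W ι) : Set (AtomBG A ι) := ERBG F (flipBG F x)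

/-- The type of a point. -/
def typBG (x : PtBG W ι) : TypBG L ι := (x.1, F.label x.2.1, x.2.2.2)

/-- `t'` is at least as good a type as `t`: no more red u-arms, a better label, the single
vertex's outside edge not turned blue. -/
def BetterBG (t' t : TypBG L ι) : Prop :=
  (∀ j, t.1 j = false → t'.1 j = false) ∧ F.BetterL t'.2.1 t.2.1 ∧ (t.2.2 = false → t'.2.2 = false)

/-- An up-set of types. -/
def IsUpBG (𝒯 : Set (TypBG L ι)) : Prop := ∀ t ∈ 𝒯, ∀ t', BetterBG F t' t → t' ∈ 𝒯

/-- The frozen blue set at the single vertex's core bit `b`: the component's blue atoms and the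
vertex when `b` and some u-arm is blue. -/
def EBpre (b : Bool) (x : PtBG W ι) : Set (AtomBG A ι) :=
  liftAtom '' EBG F.toFibreData (x.1, x.2.1) ∪ {a | a = vAtom ∧ b = true ∧ blueUG x.1}

/-- The sliced up-set of types at the single vertex's outside bit `b`. -/
def sliceTB (𝒯 : Set (TypBG L ι)) (b : Bool) : Set (TypG L ι) := {t | (t.1, t.2, b) ∈ 𝒯}

/-- The sliced up-set of atom sets at the single vertex's core bit `b`. -/
def sliceEB (𝓔 : Set (Set (AtomBG A ι))) (b : Bool) : Set (Set (AtomG A ι)) :=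
  {S | liftAtom '' S ∪ {a | a = vAtom ∧ b = true ∧ uAtomG ∈ S} ∈ 𝓔}

section Finite

variable [Fintype ι] [DecidableEq ι] [Fintype W] [DecidableEq W]

open scoped Classical in
/-- The non-leaking points whose type lies in `𝒯`. -/
noncomputable def QBG (𝒯 : Set (TypBG L ι)) : Finset (PtBG W ι) :=
  Finset.univ.filter fun x => ¬ LeakBG F x ∧ typBG F x ∈ 𝒯

end Finite

end Defs

section Lemmas

variable {W A L : Type*} {ι : Type*} (F : FibreDataBit W A L)

/-- `u` is a red atom iff some u-arm is red. -/
lemma uAtomG_mem_ERG (q : PtG W ι) : uAtomG ∈ ERG F.toFibreData q ↔ redUG q.1 := Iff.rfl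

/-- `redUG` of the flip is `blueUG`. -/
lemma redUG_flipAll (s : Config ι) : redUG (flipAll s) ↔ blueUG s := by
  simp only [redUG, blueUG, flipAll, Bool.not_eq_true']

/-- `u` is a blue atom iff some u-arm is blue. -/
lemma uAtomG_mem_EBG (q : PtG W ι) : uAtomG ∈ EBG F.toFibreData q ↔ blueUG q.1 := by
  show redUG (flipAll q.1) ↔ blueUG q.1
  exact redUG_flipAll q.1

/-- The blue atoms of a point are the frozen blue set at the flipped bit. -/
lemma EBBG_eq_EBpre (x : PtBG W ι) : EBBG F x = EBpre F (!x.2.2.1) x := by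
  simp only [EBBG, ERBG, flipBG, EBpre, EBG, flipG, redUG_flipAll]

/-- The frozen blue set is monotone in the bit. -/
lemma EBpre_false_subset (x : PtBG W ι) : EBpre F false x ⊆ EBpre F true x := by
  intro a ha
  rcases ha with ha | ⟨-, h, -⟩
  · exact Or.inl ha
  · exact Bool.noConfusion h

/-- The slice of an up-set of types is an up-set. -/
lemma isUpG_sliceTB {𝒯 : Set (TypBG L ι)} (h𝒯 : IsUpBG F 𝒯) (b : Bool) :
    IsUpG F.toFibreData (sliceTB 𝒯 b) := by
  intro t ht t' hle
  exact h𝒯 _ ht (t'.1, t'.2, b) ⟨hle.1, hle.2, fun h => h⟩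

/-- The slice of an up-set of atom sets is an up-set. -/
lemma isUpperSet_sliceEB {𝓔 : Set (Set (AtomBG A ι))} (h𝓔 : IsUpperSet 𝓔) (b : Bool) :
    IsUpperSet (sliceEB 𝓔 b) := by
  intro S S' hSS hS
  refine h𝓔 ?_ hS
  rintro a (ha | ⟨rfl, hb, hu⟩)
  · exact Or.inl (Set.image_mono hSS ha)
  · exact Or.inr ⟨rfl, hb, hSS hu⟩

/-- At a core state of the single vertex the leak is the component's. -/
lemma leakBG_core_iff {x : PtBG W ι} (hb : x.2.2.1 = x.2.2.2) :
    LeakBG F x ↔ LeakG F.toFibreData (x.1, x.2.1) := by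
  constructor
  · rintro (h | ⟨-, h1, h2⟩ | ⟨-, h1, h2⟩)
    · exact h
    · rw [hb, h2] at h1; exact Bool.noConfusion h1
    · rw [hb, h2] at h1; exact Bool.noConfusion h1
  · exact Or.inl

/-- At a core state the red atoms are the sliced form. -/
lemma ERBG_core_mem_iff {𝓔 : Set (Set (AtomBG A ι))} {x : PtBG W ι} {b : Bool}
    (hb : x.2.2 = (b, b)) : ERBG F x ∈ 𝓔 ↔ ERG F.toFibreData (x.1, x.2.1) ∈ sliceEB 𝓔 b := by
  simp only [ERBG, sliceEB, Set.mem_setOf_eq, hb, uAtomG_mem_ERG]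

/-- At a core state the frozen blue set is the sliced form. -/
lemma EBpre_core_mem_iff {𝓔 : Set (Set (AtomBG A ι))} {x : PtBG W ι} (b : Bool) :
    EBpre F b x ∈ 𝓔 ↔ EBG F.toFibreData (x.1, x.2.1) ∈ sliceEB 𝓔 b := by
  simp only [EBpre, sliceEB, Set.mem_setOf_eq, uAtomG_mem_EBG]

variable [Fintype ι] [DecidableEq ι] [Fintype W] [DecidableEq W]

open scoped Classical

omit [DecidableEq W] in
/-- Membership in `QBG`. -/
lemma mem_QBG {𝒯 : Set (TypBG L ι)} {x : PtBG W ι} :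
    x ∈ QBG F 𝒯 ↔ ¬ LeakBG F x ∧ typBG F x ∈ 𝒯 := by
  simp only [QBG, Finset.mem_filter, Finset.mem_univ, true_and]

variable [Nonempty ι]

/-- **Step 1, the frozen inequality at a core state `(b, b)` of the single vertex**: the fibre is
`QG` of the sliced up-set and the inequality is `card_le_crossGen`. -/
lemma card_frozen_leB {𝒯 : Set (TypBG L ι)} (h𝒯 : IsUpBG F 𝒯) {𝓔 : Set (Set (AtomBG A ι))}
    (h𝓔 : IsUpperSet 𝓔) (b : Bool) :
    ((QBG F 𝒯).filter fun x => x.2.2 = (b, b) ∧ ERBG F x ∈ 𝓔).card ≤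
      ((QBG F 𝒯).filter fun x => x.2.2 = (b, b) ∧ EBpre F b x ∈ 𝓔).card := by
  have key := card_le_crossGen (F := F.toFibreData) (isUpG_sliceTB F h𝒯 b) (isUpperSet_sliceEB h𝓔 b)
  have e1 : ((QBG F 𝒯).filter fun x => x.2.2 = (b, b) ∧ ERBG F x ∈ 𝓔).card =
      ((QG F.toFibreData (sliceTB 𝒯 b)).filter fun q => ERG F.toFibreData q ∈ sliceEB 𝓔 b).card := by
    refine Finset.card_bij' (fun x _ => (x.1, x.2.1)) (fun q _ => (q.1, q.2, (b, b))) ?_ ?_ ?_ ?_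
    · intro x hx
      rw [Finset.mem_filter, mem_QBG] at hx
      obtain ⟨⟨hl, ht⟩, hb, hE⟩ := hx
      rw [Finset.mem_filter, mem_QG]
      refine ⟨⟨?_, ?_⟩, ?_⟩
      · rwa [leakBG_core_iff F (by rw [hb])] at hl
      · show (x.1, F.label x.2.1, b) ∈ 𝒯
        have : typBG F x = (x.1, F.label x.2.1, b) := by simp [typBG, hb]
        rw [← this]; exact ht
      · exact (ERBG_core_mem_iff F hb).1 hE
    · intro q hq
      rw [Finset.mem_filter, mem_QG] at hq
      obtain ⟨⟨hl, ht⟩, hE⟩ := hq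
      rw [Finset.mem_filter, mem_QBG]
      refine ⟨⟨?_, ht⟩, rfl, ?_⟩
      · rw [leakBG_core_iff F rfl]; exact hl
      · exact (ERBG_core_mem_iff F rfl).2 hE
    · intro x hx
      rw [Finset.mem_filter] at hx
      obtain ⟨-, hb, -⟩ := hx
      exact Prod.ext rfl (Prod.ext rfl hb.symm)
    · intro q _
      rfl
  have e2 : ((QBG F 𝒯).filter fun x => x.2.2 = (b, b) ∧ EBpre F b x ∈ 𝓔).card =
      ((QG F.toFibreData (sliceTB 𝒯 b)).filter fun q => EBG F.toFibreData q ∈ sliceEB 𝓔 b).card := by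
    refine Finset.card_bij' (fun x _ => (x.1, x.2.1)) (fun q _ => (q.1, q.2, (b, b))) ?_ ?_ ?_ ?_
    · intro x hx
      rw [Finset.mem_filter, mem_QBG] at hx
      obtain ⟨⟨hl, ht⟩, hb, hE⟩ := hx
      rw [Finset.mem_filter, mem_QG]
      refine ⟨⟨?_, ?_⟩, ?_⟩
      · rwa [leakBG_core_iff F (by rw [hb])] at hl
      · show (x.1, F.label x.2.1, b) ∈ 𝒯
        have : typBG F x = (x.1, F.label x.2.1, b) := by simp [typBG, hb]
        rw [← this]; exact ht
      · exact (EBpre_core_mem_iff F b).1 hE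
    · intro q hq
      rw [Finset.mem_filter, mem_QG] at hq
      obtain ⟨⟨hl, ht⟩, hE⟩ := hq
      rw [Finset.mem_filter, mem_QBG]
      refine ⟨⟨?_, ht⟩, rfl, ?_⟩
      · rw [leakBG_core_iff F rfl]; exact hl
      · exact (EBpre_core_mem_iff F b).2 hE
    · intro x hx
      rw [Finset.mem_filter] at hx
      obtain ⟨-, hb, -⟩ := hx
      exact Prod.ext rfl (Prod.ext rfl hb.symm)
    · intro q _
      rfl
  rw [e1, e2]
  exact key

omit [Nonempty ι] in
/-- The one-bit cube principle. -/
lemma card_bit_le (P Q : Bool → Prop) (hP : P true → P false) (hQ : Q false → Q true) :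
    ((Finset.univ : Finset Bool).filter fun b => P b ∧ Q b).card ≤
      ((Finset.univ : Finset Bool).filter fun b => P b ∧ Q (!b)).card := by
  rw [Finset.card_filter, Finset.card_filter, Fintype.sum_bool, Fintype.sum_bool]
  simp only [Bool.not_true, Bool.not_false]
  by_cases h1 : P true <;> by_cases h2 : P false <;> by_cases h3 : Q true <;> by_cases h4 : Q false <;>
    simp [h1, h2, h3, h4] <;> first | exact absurd (hP h1) h2 | exact absurd (hQ h4) h3

omit [Nonempty ι] in
/-- **Step 2, the single vertex's bit at a fixed point of the component's cube**: the frozen blue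
count is at most the true one. -/
lemma card_bitB_le {𝒯 : Set (TypBG L ι)} (h𝒯 : IsUpBG F 𝒯) {𝓔 : Set (Set (AtomBG A ι))}
    (h𝓔 : IsUpperSet 𝓔) (q : PtG W ι) :
    ((QBG F 𝒯).filter fun x => (x.1, x.2.1) = q ∧ x.2.2.1 = x.2.2.2 ∧ EBpre F x.2.2.1 x ∈ 𝓔).card ≤
      ((QBG F 𝒯).filter fun x => (x.1, x.2.1) = q ∧ x.2.2.1 = x.2.2.2 ∧ EBBG F x ∈ 𝓔).card := by
  -- both sides are counts over the bit
  let P : Bool → Prop := fun b => (q.1, q.2, (b, b)) ∈ QBG F 𝒯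
  let Q : Bool → Prop := fun b => EBpre F b (q.1, q.2, (b, b)) ∈ 𝓔
  have hP : P true → P false := by
    intro h
    have h' : (q.1, q.2, (true, true)) ∈ QBG F 𝒯 := h
    show (q.1, q.2, (false, false)) ∈ QBG F 𝒯
    rw [mem_QBG] at h' ⊢
    refine ⟨?_, ?_⟩
    · rw [leakBG_core_iff F rfl] at h' ⊢; exact h'.1
    · exact h𝒯 _ h'.2 _ ⟨fun _ h' => h', F.betterL_refl _, fun h' => Bool.noConfusion h'⟩
  have hQ : Q false → Q true := fun h => h𝓔 (EBpre_false_subset F _) h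
  have e1 : ((QBG F 𝒯).filter fun x => (x.1, x.2.1) = q ∧ x.2.2.1 = x.2.2.2 ∧ EBpre F x.2.2.1 x ∈ 𝓔).card =
      ((Finset.univ : Finset Bool).filter fun b => P b ∧ Q b).card := by
    refine Finset.card_bij' (fun x _ => x.2.2.1) (fun b _ => (q.1, q.2, (b, b))) ?_ ?_ ?_ ?_
    · intro x hx
      rw [Finset.mem_filter] at hx
      obtain ⟨hx, hq, hb, hE⟩ := hx
      have hxq : x = (q.1, q.2, (x.2.2.1, x.2.2.1)) := by
        rw [← hq]; exact Prod.ext rfl (Prod.ext rfl (Prod.ext rfl hb.symm))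
      rw [Finset.mem_filter]
      refine ⟨Finset.mem_univ _, ?_, ?_⟩
      · show (q.1, q.2, (x.2.2.1, x.2.2.1)) ∈ QBG F 𝒯
        rw [← hxq]; exact hx
      · show EBpre F x.2.2.1 (q.1, q.2, (x.2.2.1, x.2.2.1)) ∈ 𝓔
        rw [← hxq]; exact hE
    · intro b hb
      rw [Finset.mem_filter] at hb
      obtain ⟨-, hP', hQ'⟩ := hb
      rw [Finset.mem_filter]
      exact ⟨hP', rfl, rfl, hQ'⟩
    · intro x hx
      rw [Finset.mem_filter] at hx
      obtain ⟨-, hq, hb, -⟩ := hx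
      rw [← hq]; exact Prod.ext rfl (Prod.ext rfl (Prod.ext rfl hb))
    · intro b _
      rfl
  have e2 : ((QBG F 𝒯).filter fun x => (x.1, x.2.1) = q ∧ x.2.2.1 = x.2.2.2 ∧ EBBG F x ∈ 𝓔).card =
      ((Finset.univ : Finset Bool).filter fun b => P b ∧ Q (!b)).card := by
    refine Finset.card_bij' (fun x _ => x.2.2.1) (fun b _ => (q.1, q.2, (b, b))) ?_ ?_ ?_ ?_
    · intro x hx
      rw [Finset.mem_filter] at hx
      obtain ⟨hx, hq, hb, hE⟩ := hx
      have hxq : x = (q.1, q.2, (x.2.2.1, x.2.2.1)) := by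
        rw [← hq]; exact Prod.ext rfl (Prod.ext rfl (Prod.ext rfl hb.symm))
      rw [Finset.mem_filter]
      refine ⟨Finset.mem_univ _, ?_, ?_⟩
      · show (q.1, q.2, (x.2.2.1, x.2.2.1)) ∈ QBG F 𝒯
        rw [← hxq]; exact hx
      · show EBpre F (!x.2.2.1) (q.1, q.2, (x.2.2.1, x.2.2.1)) ∈ 𝓔
        rw [← hxq, ← EBBG_eq_EBpre]; exact hE
    · intro b hb
      rw [Finset.mem_filter] at hb
      obtain ⟨-, hP', hQ'⟩ := hb
      rw [Finset.mem_filter]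
      refine ⟨hP', rfl, rfl, ?_⟩
      rw [EBBG_eq_EBpre]; exact hQ'
    · intro x hx
      rw [Finset.mem_filter] at hx
      obtain ⟨-, hq, hb, -⟩ := hx
      rw [← hq]; exact Prod.ext rfl (Prod.ext rfl (Prod.ext rfl hb))
    · intro b _
      rfl
  rw [e1, e2]
  convert card_bit_le P Q hP hQ

end Lemmas

end CrossArm

end Summit.Ventures.PercRepro2
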